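import Summits.Ventures.YMGap.Thresholds.CumulantCalculus
import Summits.Ventures.YMGap.Thresholds.TruncatedTools
import Summits.Ventures.YMGap.Thresholds.ConnectedThreePointDecaySUN
import HarnessLib

/-!
# Venture YMGap — C-SMOOTH for every `SU(N)` (i-a): the slot data and ONE Dobrushin–Shlosman split for the truncated
# functions of every order of the `SU(N)`, `d = 4` strong-coupling state under the one-link modulus hypotheses

HONEST FRAMING: venture file of the cell `pub-ymgap` (QuantumFields programme), seat ds-1 (gen 12).  `SU(N)` twin of
`TruncatedSplit` (§3–§4 there): strong-coupling LATTICE statements for `SU(N)` lattice Yang–Mills on `ℤ^4` with the Wilson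
action at tree coupling `0 ≤ b ≤ b₁` inside a vertex-star window given by a one-link Kantorovich modulus
(`OneLinkKRModulus N R Kc`, `6 b₁/N ≤ R`, `4 Kc b₁/N ≤ 9/25`; hypothesis-free for `N ≥ 2` at 't Hooft `b/N ≤ 9/308` via the
Bakry–Émery modulus, see `TruncatedTreeDecaySUN`); covariance bookkeeping only; nothing about the continuum, confinement
at weak coupling, or the Clay problem.  The pigeonhole cut `exists_gap` and `isLipschitzCylinder_prod` are imported from
`TruncatedTools` (they do not see `N`).

* `slot_data_SU` — uniform Lipschitz data of `slots F W q` for `SU(N)` (`W_q = (1/N) Re tr U_q`, constant `K + 4N³`);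
* ★ `abs_mom_sub_mom_mul_mom_le_SU` — ONE SPLIT under the modulus hypotheses (g10's `abs_cov_le_of_sep_SU`).
-/

noncomputable section

open MeasureTheory ProbabilityTheory Function Finset Filter Topology Real Set
open scoped NNReal
open Literature.MathematicalPhysics.QuantumLattice (LGConfig ZdEdge ZdPlaquette plaquetteEdges fundamentalRep
  fundamentalRep_mem_unitaryGroup ymGibbsMeasures)
open Literature.MathematicalPhysics.QuantumFieldTheory hiding ZdEdge
open Literature.MathematicalPhysics.QuantumFieldTheory.Balaban1983to89.StrongCouplingDobrushinWindow (OneLinkKRModulus)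
open Literature.Probability.LatticeModels (Site Site.supNorm Site.norm_eq_supNorm Site.supNorm_eq_zero_iff)
open Summit.Ventures.YMGap.DSWindow (starRate starRate_pos)
open Summit.Ventures.YMGap.StarWindowGauge (gaugeR)
open Summit.Ventures.YMGap.RobustBall (l1 numOrient)
open Summit.Ventures.YMGap.Cumulants

namespace Summit.Ventures.YMGap.CouplingResponse

variable {N : ℕ}

/-- Local shorthand: the normalised plaquette observable `W_q = (1/N) Re tr U_q` of `SU(N)` on `ℤ⁴`, as a family. -/
local notation3 (prettyPrint := false) "𝓦" =>
  fun q : ZdPlaquette 4 => zdPlaquetteObs (d := 4) (fundamentalRep (Fin N)) (Prod.fst q) (Prod.snd q).1.1 (Prod.snd q).1.2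

/-! ### §1 The `SU(N)` slot family: uniform Lipschitz data -/

/-- **Uniform data of the slots** (`SU(N)`, `d = 4`): every slot of `slots F W q` is a Lipschitz cylinder with constant
`K + 4N³`, bounded by `|F 1| + 2K + 1`, supported on at most `#Λ + 4` links, all within sup-distance `D + 1` of a
centre which is `x₀` for the slot of `F` and `x_{q j}` for the slot of `W_{q j}` (junk slots: the constant `1`, empty
support, centre `x₀`). -/
theorem slot_data_SU {F : LGConfig 4 (Matrix.specialUnitaryGroup (Fin N) ℂ) → ℝ} {Λ : Finset (ZdEdge 4)} {K : ℝ≥0}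
    (hF : IsLipschitzCylinder (fundamentalRep (Fin N)) F Λ K)
    {x₀ : Site 4} {D : ℕ} (hD : ∀ e ∈ Λ, ‖e.1 - x₀‖ ≤ D) {n : ℕ} (q : Fin n → ZdPlaquette 4) (i : ℕ) :
    ∃ (Λi : Finset (ZdEdge 4)) (ci : Site 4),
      IsLipschitzCylinder (fundamentalRep (Fin N)) (slots F 𝓦 q i) Λi (K + 4 * (N : ℝ≥0) ^ 3) ∧
      (∀ U, |slots F 𝓦 q i U| ≤ ((‖F 1‖₊ + 2 * K + 1 : ℝ≥0) : ℝ)) ∧ Λi.card ≤ Λ.card + 4 ∧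
      (∀ e ∈ Λi, ‖e.1 - ci‖ ≤ ((D + 1 : ℕ) : ℝ)) ∧ (i = 0 → ci = x₀) ∧ (∀ j : Fin n, i = j.1 + 1 → ci = (q j).1) := by
  classical
  have hB : ((‖F 1‖₊ + 2 * K + 1 : ℝ≥0) : ℝ) = |F 1| + 2 * K + 1 := by
    push_cast; rw [Real.norm_eq_abs]
  rcases i with _ | j
  · refine ⟨Λ, x₀, ?_, fun U => ?_, by omega, fun e he => ?_, fun _ => rfl, fun j hj => absurd hj (by omega)⟩
    · simpa using ZdSmoothing.isLipschitzCylinder_mono hF (show K ≤ K + 4 * (N : ℝ≥0) ^ 3 from le_self_add)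
    · rw [hB, slots_zero]; linarith [hF.abs_le U]
    · push_cast; linarith [hD e he]
  · by_cases hj : j < n
    · obtain ⟨hW, -, hW1, hq1, hcq⟩ := plaquetteObs_data_SU (N := N) (q ⟨j, hj⟩)
      refine ⟨plaquetteEdges (q ⟨j, hj⟩), (q ⟨j, hj⟩).1, ?_, fun U => ?_, ?_, fun e he => ?_,
        fun h => absurd h (by omega), fun j' hj' => ?_⟩
      · rw [slots_succ_of_lt _ _ _ hj]
        exact ZdSmoothing.isLipschitzCylinder_mono hW (by
          rw [add_comm]; exact le_self_add)
      · rw [slots_succ_of_lt _ _ _ hj, hB]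
        have := hW1 U
        push_cast at this
        have hK : (0 : ℝ) ≤ K := K.2
        linarith [abs_nonneg (F 1)]
      · have := card_plaquetteEdges_le (q ⟨j, hj⟩); omega
      · have := hq1 e he
        push_cast at this ⊢
        linarith
      · have e : (⟨j, hj⟩ : Fin n) = j' := Fin.ext (by simpa using hj')
        rw [e]
    · refine ⟨∅, x₀, ?_, fun U => ?_, by simp, fun e he => absurd he (Finset.notMem_empty _), fun h => absurd h (by omega),
        fun j' hj' => absurd (show j = j'.1 by omega) (by have := j'.2; omega)⟩
      · rw [slots_succ_of_le _ _ _ (not_lt.1 hj)]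
        exact ZdSmoothing.isLipschitzCylinder_of_dist_le fun U V => by
          simp only [sub_self, abs_zero]; positivity
      · rw [slots_succ_of_le _ _ _ (not_lt.1 hj), hB]
        have hK : (0 : ℝ) ≤ K := K.2
        simp only [abs_one]
        linarith [abs_nonneg (F 1)]

/-! ### §2 One split for `SU(N)` under the modulus hypotheses -/

/-- **ONE SPLIT** (`SU(N)`, `d = 4`): let `X` be a family of Lipschitz cylinders (constant `K₀`, bound `B₀ ≥ 1`,
supports `Λs i` of at most `c₀` links within `D'` of centres `cs i`) on an index set `S`, and let a cut `p` separate
the centres: `‖cs i − cs j‖ ≥ g` whenever `p i`, `¬p j`.  Then for the DLR state `μ` at any `0 ≤ b ≤ b₁` (modulus hypotheses `OneLinkKRModulus N R Kc`,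
`6b₁/N ≤ R`, `4Kc b₁/N ≤ 9/25`) and every `T ⊆ S`:
`|m(T) − m(T_p) m(T_{¬p})| ≤ 4(2√N)² e^{−κ((g−(2D'+2))−2)} (|S|² c₀ K₀ B₀^{|S|})² · ∏_{i∈T} B₀`, `κ = starRate(R_G(4Kc b₁/N))`
(the difference is `Cov(∏_{T_p} X, ∏_{T_{¬p}} X)`, clustered by g10's `abs_cov_le_of_sep_SU`). -/
theorem abs_mom_sub_mom_mul_mom_le_SU (hN : 1 ≤ N) {R Kc b₁ : ℝ} (hK0 : 0 ≤ Kc)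
    (hmod : OneLinkKRModulus N R Kc) (hR : b₁ / N * 6 ≤ R) (h925 : 4 * (Kc * (b₁ / N)) ≤ 9 / 25)
    {b : ℝ} (h0 : 0 ≤ b) (hb' : b ≤ b₁)
    {μ : Measure (LGConfig 4 (Matrix.specialUnitaryGroup (Fin N) ℂ))}
    (hμ : μ ∈ ymGibbsMeasures (d := 4) (fundamentalRep (Fin N)) b)
    {X : ℕ → LGConfig 4 (Matrix.specialUnitaryGroup (Fin N) ℂ) → ℝ} {Λs : ℕ → Finset (ZdEdge 4)} {cs : ℕ → Site 4}
    {K₀ B₀ : ℝ≥0} {c₀ D' g : ℕ} {S : Finset ℕ} (hB : 1 ≤ B₀)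
    (hX : ∀ i ∈ S, IsLipschitzCylinder (fundamentalRep (Fin N)) (X i) (Λs i) K₀) (hM : ∀ i ∈ S, ∀ U, |X i U| ≤ B₀)
    (hc : ∀ i ∈ S, (Λs i).card ≤ c₀) (hnear : ∀ i ∈ S, ∀ e ∈ Λs i, ‖e.1 - cs i‖ ≤ D')
    (p : ℕ → Prop) [DecidablePred p] (hsep : ∀ i ∈ S, ∀ j ∈ S, p i → ¬p j → (g : ℝ) ≤ ‖cs i - cs j‖) :
    ∀ T ⊆ S, |mom μ X T - mom μ X (T.filter p) * mom μ X (T.filter fun i => ¬p i)| ≤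
      4 * (2 * Real.sqrt N) ^ 2 * Real.exp (-(starRate (gaugeR (4 * (Kc * (b₁ / N)))) * (((g - (2 * D' + 2) : ℕ) - 2 : ℕ) : ℝ))) *
        (((S.card : ℝ) ^ 2 * c₀ * K₀ * (B₀ : ℝ) ^ S.card) ^ 2) * ∏ _i ∈ T, (B₀ : ℝ) := by
  classical
  intro T hTS
  haveI : IsProbabilityMeasure μ := hμ.1
  set Tp := T.filter p with hTp
  set Tn := T.filter (fun i => ¬p i) with hTn
  have hTpS : Tp ⊆ S := (Finset.filter_subset _ _).trans hTS
  have hTnS : Tn ⊆ S := (Finset.filter_subset _ _).trans hTS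
  obtain ⟨hLp, hBp⟩ := isLipschitzCylinder_prod hB Tp (fun i hi => hX i (hTpS hi)) (fun i hi => hM i (hTpS hi))
  obtain ⟨hLn, hBn⟩ := isLipschitzCylinder_prod hB Tn (fun i hi => hX i (hTnS hi)) (fun i hi => hM i (hTnS hi))
  -- the difference is a covariance
  have hcov : mom μ X T - mom μ X Tp * mom μ X Tn = cov[fun U => ∏ i ∈ Tp, X i U, fun U => ∏ i ∈ Tn, X i U; μ] := by
    rw [covariance_eq_sub_of_abs_le hLp.measurable hLn.measurable hBp hBn]
    simp only [mom, hTp, hTn]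
    congr 1
    congr 1
    funext U
    rw [Finset.prod_filter_mul_prod_filter_not]
  -- separation of the two supports
  have hgeom : ∀ a ∈ Tp.biUnion Λs, ∀ b ∈ Tn.biUnion Λs, (((g - (2 * D' + 2) : ℕ) : ℕ) : ℝ) ≤ ‖a.1 - b.1‖ := by
    intro a ha b hb
    obtain ⟨i, hi, hai⟩ := Finset.mem_biUnion.1 ha
    obtain ⟨j, hj, hbj⟩ := Finset.mem_biUnion.1 hb
    have hpi : p i := (Finset.mem_filter.1 hi).2
    have hpj : ¬p j := (Finset.mem_filter.1 hj).2
    have hg := hsep i (hTpS hi) j (hTnS hj) hpi hpj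
    refine sep_of_near (D₁ := D') (D₂ := D') (fun e he => hnear i (hTpS hi) e he) (fun e he => hnear j (hTnS hj) e he)
      ?_ a hai b hbj
    have hg' : g ≤ Site.supNorm (cs i - cs j) := by
      rw [Site.norm_eq_supNorm] at hg; exact_mod_cast hg
    omega
  have h := abs_cov_le_of_sep_SU hN hK0 hmod hR h925 h0 hb' hμ hLp hLn hgeom
  rw [← hcov] at h
  refine h.trans ?_
  -- crude bookkeeping of the constants
  set E : ℝ := 4 * (2 * Real.sqrt N) ^ 2 *
    Real.exp (-(starRate (gaugeR (4 * (Kc * (b₁ / N)))) * (((g - (2 * D' + 2) : ℕ) - 2 : ℕ) : ℝ))) with hE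
  have hE0 : 0 ≤ E := by positivity
  have hB1 : (1 : ℝ) ≤ B₀ := by exact_mod_cast hB
  have hK0 : (0 : ℝ) ≤ K₀ := K₀.2
  have hcardp : (Tp.card : ℝ) ≤ S.card := by exact_mod_cast Finset.card_le_card hTpS
  have hcardn : (Tn.card : ℝ) ≤ S.card := by exact_mod_cast Finset.card_le_card hTnS
  have hUp : ((Tp.biUnion Λs).card : ℝ) ≤ S.card * c₀ := by
    have h1' : (Tp.biUnion Λs).card ≤ Tp.card * c₀ :=
      Finset.card_biUnion_le.trans (by
        simpa using Finset.sum_le_card_nsmul Tp (fun i => (Λs i).card) c₀ fun i hi => hc i (hTpS hi))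
    calc ((Tp.biUnion Λs).card : ℝ) ≤ Tp.card * c₀ := by exact_mod_cast h1'
      _ ≤ S.card * c₀ := by gcongr
  have hUn : ((Tn.biUnion Λs).card : ℝ) ≤ S.card * c₀ := by
    have h1' : (Tn.biUnion Λs).card ≤ Tn.card * c₀ :=
      Finset.card_biUnion_le.trans (by
        simpa using Finset.sum_le_card_nsmul Tn (fun i => (Λs i).card) c₀ fun i hi => hc i (hTnS hi))
    calc ((Tn.biUnion Λs).card : ℝ) ≤ Tn.card * c₀ := by exact_mod_cast h1'
      _ ≤ S.card * c₀ := by gcongr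
  have hKp : ((Tp.card * K₀ * B₀ ^ Tp.card : ℝ≥0) : ℝ) ≤ S.card * K₀ * (B₀ : ℝ) ^ S.card := by
    push_cast
    exact mul_le_mul (mul_le_mul_of_nonneg_right hcardp hK0) (pow_le_pow_right₀ hB1 (Finset.card_le_card hTpS))
      (by positivity) (by positivity)
  have hKn : ((Tn.card * K₀ * B₀ ^ Tn.card : ℝ≥0) : ℝ) ≤ S.card * K₀ * (B₀ : ℝ) ^ S.card := by
    push_cast
    exact mul_le_mul (mul_le_mul_of_nonneg_right hcardn hK0) (pow_le_pow_right₀ hB1 (Finset.card_le_card hTnS))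
      (by positivity) (by positivity)
  have hprod : (1 : ℝ) ≤ ∏ _i ∈ T, (B₀ : ℝ) := by
    rw [Finset.prod_const]; exact one_le_pow₀ hB1
  have hblock : ∀ {u k : ℝ}, 0 ≤ u → 0 ≤ k → u ≤ S.card * c₀ → k ≤ S.card * K₀ * (B₀ : ℝ) ^ S.card →
      u * k ≤ (S.card : ℝ) ^ 2 * c₀ * K₀ * (B₀ : ℝ) ^ S.card := by
    intro u k hu hk hu' hk'
    calc u * k ≤ (S.card * c₀) * (S.card * K₀ * (B₀ : ℝ) ^ S.card) := mul_le_mul hu' hk' hk (by positivity)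
      _ = _ := by ring
  have hp' := hblock (Nat.cast_nonneg _) (by positivity) hUp hKp
  have hn' := hblock (Nat.cast_nonneg _) (by positivity) hUn hKn
  have hQ : 0 ≤ (S.card : ℝ) ^ 2 * c₀ * K₀ * (B₀ : ℝ) ^ S.card := by positivity
  calc E * (((Tp.biUnion Λs).card : ℝ) * ((Tp.card * K₀ * B₀ ^ Tp.card : ℝ≥0) : ℝ)) *
        (((Tn.biUnion Λs).card : ℝ) * ((Tn.card * K₀ * B₀ ^ Tn.card : ℝ≥0) : ℝ))
      ≤ E * ((S.card : ℝ) ^ 2 * c₀ * K₀ * (B₀ : ℝ) ^ S.card) * ((S.card : ℝ) ^ 2 * c₀ * K₀ * (B₀ : ℝ) ^ S.card) := by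
        gcongr
    _ = E * ((S.card : ℝ) ^ 2 * c₀ * K₀ * (B₀ : ℝ) ^ S.card) ^ 2 * 1 := by ring
    _ ≤ E * ((S.card : ℝ) ^ 2 * c₀ * K₀ * (B₀ : ℝ) ^ S.card) ^ 2 * ∏ _i ∈ T, (B₀ : ℝ) := by
        gcongr

end Summit.Ventures.YMGap.CouplingResponse

end
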